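import Summits.HodgeConjecture.HodgeConjecture.Theorems.Ring2WeilCoverageFrameFreePlacement
import Summits.HodgeConjecture.HodgeConjecture.Theorems.Ring2WeilNormObstructionGenusFieldsA
import Summits.HodgeConjecture.HodgeConjecture.Theorems.Ring2WeilNormObstructionGenusFieldsB
import HarnessLib

/-!
# Weil-type family coverage — frame-free placement B: the `Dic₁₃` Jacobian twelvefold and the binary octahedral fourfolds

research route conditional on HC_CM; not a corollary; Q11.4-sentence-2 already refuted in dim ≥ 3.

Ring 2, WEIL-TYPE FAMILY-COVERAGE CENSUS (`HOME/WEIL-FAMILY-COVERAGE.md` `## b04`, block b04.10 (B4) and (E), owner ring2-b04),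
companion of `Ring2WeilCoverageFrameFreePlacement` (the frame-free placement theorem: `a(P, K, Θ) ≡ C(P,Θ) · N_{F/ℚ}(ν_K)^k`,
`C = N_{F/ℚ}(Nrd cᵗ)` one exact rational per datum).  This file carries the census sentences of two further sets of data
whose invariant `C` is NOT a square and whose algebra term is trivial (`n = 13 ≡ 1 (mod 4)`, resp. `F = ℚ(√2)` with one prime
over `2`; `R(D) = ∅`, `e` even), so that the class of `(P, K, Θ)` is literally `[C]` for every imaginary quadratic `K`:

* §1 norm facts at `13` and `2`: `SqrtNeg19/67/163/15.not_mem_13` (inert descents), `SqrtNeg10.not_mem_13` (ramified descent at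
  `5`), `SqrtNeg23.mem_13` (`13 = (5/3)² + 23·(2/3)²`), `SqrtNeg13.mem_13`;
* §2 the PRINCIPALLY POLARISED CM JACOBIAN `J(C̃₁₂)` of the `Dic₁₃`-curve of signature `(0; 4, 4, 13)` (genus 12; the whole
  Jacobian is the quaternion piece, `k = 1`): `C = 13⁻¹¹ ≡ 13` — NON-split (`[13⁻¹¹] ≠ split 6 d`) for the ten census fields with
  `13 ∉ Nm(ℚ(√-d)ˣ)` (`d = 2, 7, 11, 19, 67, 163, 5, 6, 15` (13 inert) and `d = 10`), split for `d = 3, 13, 23` — a principally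
  polarised Jacobian on non-split twelvefold rows, possible exactly because `K` acts through `(1/13)ℤ[Dic₁₃]` there (no integral frame);
* §3 the binary octahedral group `2O`: its quaternionic component is `D₄ = ℍ_ℚ ⊗ ℚ(√2)` (`Q₁₆ = ⟨ζ₈, j⟩ ⊂ 2O`); the rigid CM
  FOURFOLDS `(0; 3, 4, 8)` (genus 8) have `C = 1/1152 = 2·(1/48)²` (resp. `1/288`, `1/2592` on the other components / on `(0;4,6,8)`,
  the same class): NON-split rows `W4.d.2` for the eleven fields with `2 ∉ Nm` — `[1/1152] ≠ split 2 d`.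

All norm facts not proved here are REUSED BY NAME (ring2-b02: `thirteen_not_mem_norm_two/seven`, `two_not_mem_norm_three/eleven`,
`Ring2WeilNormDescent.SqrtNeg5/6/10/13/15.not_mem_2`, `….SqrtNeg5/6.not_mem_13`; ring2-b04: `SqrtNeg11.not_mem_13`,
`SqrtNeg19/43/67/163.not_mem_2`, `SqrtNeg3.mem_13`).  No `def`, no named fact, no `sorry`; nothing here is a statement about
Hodge classes (the fourfold rows are in print [Markman 2023] anyway); `HC_CM` is used nowhere.

References: [cite: vanGeemen1994HodgeAV, 5.4 and (5.4.1)]; [cite: Serre1973, Ch. III §1].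
-/

noncomputable section

set_option linter.dupNamespace false

open Literature.AlgebraicGeometry.Motives
open Literature.AlgebraicGeometry.VanGeemen1994
open Summit.HodgeConjecture.HodgeConjecture.Ring2.Hypotheses

namespace Summit.HodgeConjecture.HodgeConjecture.Ring2.WeilCoverage

/-! ### §1 Norm facts -/

namespace SqrtNeg19

/-- `13 ∉ Nm(ℚ(√-19)ˣ)`: descent at the inert prime `13` (`-19 ≡ 7` is a non-square mod `13`).
research route conditional on HC_CM; not a corollary; Q11.4-sentence-2 already refuted in dim ≥ 3. [cite: Serre1973, Ch. III §1] -/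
theorem not_mem_13 : Units.mk0 (13 : ℚ) (by norm_num) ∉ normUnitsSubgroup ℚ (weilField 19) := by
  simpa using natCast_not_mem_normUnitsSubgroup_of_inert (d := 19) (a := 13) (p := 13)
    (by norm_num) (by decide) (by norm_num) (by norm_num) (by norm_num)

end SqrtNeg19

namespace SqrtNeg67

/-- `13 ∉ Nm(ℚ(√-67)ˣ)`: descent at the inert prime `13` (`-67 ≡ 11` is a non-square mod `13`).
research route conditional on HC_CM; not a corollary; Q11.4-sentence-2 already refuted in dim ≥ 3. [cite: Serre1973, Ch. III §1] -/
theorem not_mem_13 : Units.mk0 (13 : ℚ) (by norm_num) ∉ normUnitsSubgroup ℚ (weilField 67) := by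
  simpa using natCast_not_mem_normUnitsSubgroup_of_inert (d := 67) (a := 13) (p := 13)
    (by norm_num) (by decide) (by norm_num) (by norm_num) (by norm_num)

end SqrtNeg67

namespace SqrtNeg163

/-- `13 ∉ Nm(ℚ(√-163)ˣ)`: descent at the inert prime `13` (`-163 ≡ 6` is a non-square mod `13`).
research route conditional on HC_CM; not a corollary; Q11.4-sentence-2 already refuted in dim ≥ 3. [cite: Serre1973, Ch. III §1] -/
theorem not_mem_13 : Units.mk0 (13 : ℚ) (by norm_num) ∉ normUnitsSubgroup ℚ (weilField 163) := by
  simpa using natCast_not_mem_normUnitsSubgroup_of_inert (d := 163) (a := 13) (p := 13)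
    (by norm_num) (by decide) (by norm_num) (by norm_num) (by norm_num)

end SqrtNeg163

namespace SqrtNeg15

/-- `13 ∉ Nm(ℚ(√-15)ˣ)`: descent at the inert prime `13` (`-15 ≡ 11` is a non-square mod `13`).
research route conditional on HC_CM; not a corollary; Q11.4-sentence-2 already refuted in dim ≥ 3. [cite: Serre1973, Ch. III §1] -/
theorem not_mem_13 : Units.mk0 (13 : ℚ) (by norm_num) ∉ normUnitsSubgroup ℚ (weilField 15) := by
  simpa using natCast_not_mem_normUnitsSubgroup_of_inert (d := 15) (a := 13) (p := 13)
    (by norm_num) (by decide) (by norm_num) (by norm_num) (by norm_num)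

end SqrtNeg15

namespace SqrtNeg10

/-- `13 ∉ Nm(ℚ(√-10)ˣ)` although `13` SPLITS in `ℚ(√-10)` (`-10 ≡ 4²` mod `13`): descent at the RAMIFIED prime `5` (`13 ≡ 3` is a
non-square mod `5`); `T(13) = {2, 5}`.
research route conditional on HC_CM; not a corollary; Q11.4-sentence-2 already refuted in dim ≥ 3. [cite: Serre1973, Ch. III §1] -/
theorem not_mem_13 : Units.mk0 (13 : ℚ) (by norm_num) ∉ normUnitsSubgroup ℚ (weilField 10) := by
  simpa using natCast_not_mem_normUnitsSubgroup_of_ramified (d := 10) (a := 13) (p := 5)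
    (by norm_num) (by norm_num) (by norm_num) (by decide) (by norm_num)

end SqrtNeg10

namespace SqrtNeg23

/-- `13 ∈ Nm(ℚ(√-23)ˣ)`: `13 = (5/3)² + 23·(2/3)²` (both `13` and `3` split in `ℚ(√-23)`; a rational, not integral, representation).
research route conditional on HC_CM; not a corollary; Q11.4-sentence-2 already refuted in dim ≥ 3. [cite: vanGeemen1994HodgeAV, (5.4.1)] -/
theorem mem_13 : Units.mk0 (13 : ℚ) (by norm_num) ∈ normUnitsSubgroup ℚ (weilField 23) :=
  mem_normUnitsSubgroup_of_sq_add_mul_sq _ (5 / 3) (2 / 3) (by norm_num)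

end SqrtNeg23

namespace SqrtNeg13

/-- `13 ∈ Nm(ℚ(√-13)ˣ)`: `13 = 0² + 13·1² = Nm(√-13)`. research route conditional on HC_CM; not a corollary; Q11.4-sentence-2 already refuted in dim ≥ 3. [cite: vanGeemen1994HodgeAV, (5.4.1)] -/
theorem mem_13 : Units.mk0 (13 : ℚ) (by norm_num) ∈ normUnitsSubgroup ℚ (weilField 13) :=
  mem_normUnitsSubgroup_of_sq_add_mul_sq _ 0 1 (by norm_num)

end SqrtNeg13

/-! ### §2 The `Dic₁₃` Jacobian twelvefold `J(C̃₁₂)`, `C = 13⁻¹¹` -/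

section Dic13Jacobian

/-- `1 ∈ Nm(K_dˣ)` for every `d` (bookkeeping for the shell). research route conditional on HC_CM; not a corollary; Q11.4-sentence-2 already refuted in dim ≥ 3. [folklore] -/
theorem one_mem_normUnitsSubgroup (d : ℕ) : Units.mk0 (1 : ℚ) one_ne_zero ∈ normUnitsSubgroup ℚ (weilField d) :=
  mem_normUnitsSubgroup_of_sq_add_mul_sq _ 1 0 (by norm_num)

/-- **The frame-free class of the `Dic₁₃` Jacobian twelvefold is `[13]`**: with `C = 13⁻¹¹ = 13 · (13⁻⁶)²` (exact value on the census
engine's `D₁₃`-generator) the component of `(J(C̃₁₂), K, Θ)` for `K = ℚ(√-d)` is the split one iff `13 ∈ Nm(ℚ(√-d)ˣ)` — one line over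
the shell of part A (`n = 6` even, `ν = 1`).
research route conditional on HC_CM; not a corollary; Q11.4-sentence-2 already refuted in dim ≥ 3. [cite: vanGeemen1994HodgeAV, (5.4.1)] -/
theorem twelvefold_dic13Jacobian_mk_C_eq_split_iff (d : ℕ) :
    (QuotientGroup.mk (Units.mk0 ((1 : ℚ) / 13 ^ 11) (by norm_num)) : weilNormResidueGroup d) =
      splitDiscriminantClass 6 d ↔ Units.mk0 (13 : ℚ) (by norm_num) ∈ normUnitsSubgroup ℚ (weilField d) :=
  mk_eq_split_iff_of_eq_mul_norm_mul_sq (n := 6) (by decide) (a := (1 : ℚ) / 13 ^ 11) (C := 13) (ν := 1)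
    (s := (1 : ℚ) / 13 ^ 6) (by norm_num) (by norm_num) one_ne_zero (by norm_num) (by norm_num)
    (one_mem_normUnitsSubgroup d)

/-- `J(C̃₁₂)` at `ℚ(√-2)` (13 inert): NON-split, row `W12.2.13`. research route conditional on HC_CM; not a corollary; Q11.4-sentence-2 already refuted in dim ≥ 3. [cite: vanGeemen1994HodgeAV, (5.4.1)] -/
theorem twelvefold_sqrtNeg2_dic13Jacobian_ne_split :
    (QuotientGroup.mk (Units.mk0 ((1 : ℚ) / 13 ^ 11) (by norm_num)) : weilNormResidueGroup 2) ≠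
      splitDiscriminantClass 6 2 := fun h =>
  Summit.HodgeConjecture.Ring2WeilNormDescent.thirteen_not_mem_norm_two ((twelvefold_dic13Jacobian_mk_C_eq_split_iff 2).1 h)

/-- `J(C̃₁₂)` at `ℚ(√-7)`: NON-split, row `W12.7.13`. research route conditional on HC_CM; not a corollary; Q11.4-sentence-2 already refuted in dim ≥ 3. [cite: vanGeemen1994HodgeAV, (5.4.1)] -/
theorem twelvefold_sqrtNeg7_dic13Jacobian_ne_split :
    (QuotientGroup.mk (Units.mk0 ((1 : ℚ) / 13 ^ 11) (by norm_num)) : weilNormResidueGroup 7) ≠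
      splitDiscriminantClass 6 7 := fun h =>
  Summit.HodgeConjecture.Ring2WeilNormDescent.thirteen_not_mem_norm_seven ((twelvefold_dic13Jacobian_mk_C_eq_split_iff 7).1 h)

/-- `J(C̃₁₂)` at `ℚ(√-11)`: NON-split, row `W12.11.13`. research route conditional on HC_CM; not a corollary; Q11.4-sentence-2 already refuted in dim ≥ 3. [cite: vanGeemen1994HodgeAV, (5.4.1)] -/
theorem twelvefold_sqrtNeg11_dic13Jacobian_ne_split :
    (QuotientGroup.mk (Units.mk0 ((1 : ℚ) / 13 ^ 11) (by norm_num)) : weilNormResidueGroup 11) ≠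
      splitDiscriminantClass 6 11 := fun h =>
  SqrtNeg11.not_mem_13 ((twelvefold_dic13Jacobian_mk_C_eq_split_iff 11).1 h)

/-- `J(C̃₁₂)` at `ℚ(√-19)`: NON-split, row `W12.19.13`. research route conditional on HC_CM; not a corollary; Q11.4-sentence-2 already refuted in dim ≥ 3. [cite: vanGeemen1994HodgeAV, (5.4.1)] -/
theorem twelvefold_sqrtNeg19_dic13Jacobian_ne_split :
    (QuotientGroup.mk (Units.mk0 ((1 : ℚ) / 13 ^ 11) (by norm_num)) : weilNormResidueGroup 19) ≠
      splitDiscriminantClass 6 19 := fun h =>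
  SqrtNeg19.not_mem_13 ((twelvefold_dic13Jacobian_mk_C_eq_split_iff 19).1 h)

/-- `J(C̃₁₂)` at `ℚ(√-67)`: NON-split, row `W12.67.13`. research route conditional on HC_CM; not a corollary; Q11.4-sentence-2 already refuted in dim ≥ 3. [cite: vanGeemen1994HodgeAV, (5.4.1)] -/
theorem twelvefold_sqrtNeg67_dic13Jacobian_ne_split :
    (QuotientGroup.mk (Units.mk0 ((1 : ℚ) / 13 ^ 11) (by norm_num)) : weilNormResidueGroup 67) ≠
      splitDiscriminantClass 6 67 := fun h =>
  SqrtNeg67.not_mem_13 ((twelvefold_dic13Jacobian_mk_C_eq_split_iff 67).1 h)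

/-- `J(C̃₁₂)` at `ℚ(√-163)`: NON-split, row `W12.163.13`. research route conditional on HC_CM; not a corollary; Q11.4-sentence-2 already refuted in dim ≥ 3. [cite: vanGeemen1994HodgeAV, (5.4.1)] -/
theorem twelvefold_sqrtNeg163_dic13Jacobian_ne_split :
    (QuotientGroup.mk (Units.mk0 ((1 : ℚ) / 13 ^ 11) (by norm_num)) : weilNormResidueGroup 163) ≠
      splitDiscriminantClass 6 163 := fun h =>
  SqrtNeg163.not_mem_13 ((twelvefold_dic13Jacobian_mk_C_eq_split_iff 163).1 h)

/-- `J(C̃₁₂)` at `ℚ(√-5)`: NON-split, row `W12.5.13`. research route conditional on HC_CM; not a corollary; Q11.4-sentence-2 already refuted in dim ≥ 3. [cite: vanGeemen1994HodgeAV, (5.4.1)] -/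
theorem twelvefold_sqrtNeg5_dic13Jacobian_ne_split :
    (QuotientGroup.mk (Units.mk0 ((1 : ℚ) / 13 ^ 11) (by norm_num)) : weilNormResidueGroup 5) ≠
      splitDiscriminantClass 6 5 := fun h =>
  Summit.HodgeConjecture.Ring2WeilNormDescent.SqrtNeg5.not_mem_13 ((twelvefold_dic13Jacobian_mk_C_eq_split_iff 5).1 h)

/-- `J(C̃₁₂)` at `ℚ(√-6)`: NON-split, row `W12.6.13`. research route conditional on HC_CM; not a corollary; Q11.4-sentence-2 already refuted in dim ≥ 3. [cite: vanGeemen1994HodgeAV, (5.4.1)] -/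
theorem twelvefold_sqrtNeg6_dic13Jacobian_ne_split :
    (QuotientGroup.mk (Units.mk0 ((1 : ℚ) / 13 ^ 11) (by norm_num)) : weilNormResidueGroup 6) ≠
      splitDiscriminantClass 6 6 := fun h =>
  Summit.HodgeConjecture.Ring2WeilNormDescent.SqrtNeg6.not_mem_13 ((twelvefold_dic13Jacobian_mk_C_eq_split_iff 6).1 h)

/-- `J(C̃₁₂)` at `ℚ(√-15)`: NON-split, row `W12.15.13`. research route conditional on HC_CM; not a corollary; Q11.4-sentence-2 already refuted in dim ≥ 3. [cite: vanGeemen1994HodgeAV, (5.4.1)] -/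
theorem twelvefold_sqrtNeg15_dic13Jacobian_ne_split :
    (QuotientGroup.mk (Units.mk0 ((1 : ℚ) / 13 ^ 11) (by norm_num)) : weilNormResidueGroup 15) ≠
      splitDiscriminantClass 6 15 := fun h =>
  SqrtNeg15.not_mem_13 ((twelvefold_dic13Jacobian_mk_C_eq_split_iff 15).1 h)

/-- `J(C̃₁₂)` at `ℚ(√-10)` (13 split in `K`, but `13 ∉ Nm`, `T = {2,5}`): NON-split, row `W12.10.2`. research route conditional on HC_CM; not a corollary; Q11.4-sentence-2 already refuted in dim ≥ 3. [cite: vanGeemen1994HodgeAV, (5.4.1)] -/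
theorem twelvefold_sqrtNeg10_dic13Jacobian_ne_split :
    (QuotientGroup.mk (Units.mk0 ((1 : ℚ) / 13 ^ 11) (by norm_num)) : weilNormResidueGroup 10) ≠
      splitDiscriminantClass 6 10 := fun h =>
  SqrtNeg10.not_mem_13 ((twelvefold_dic13Jacobian_mk_C_eq_split_iff 10).1 h)

/-- `J(C̃₁₂)` at `ℚ(√-3)` (`13 = 1² + 3·2²`): SPLIT, row `W12.3.1` — here an integral `ℚ(√-3)`-frame exists and the class must be
split (free `O_K`-lattice, principal polarisation). research route conditional on HC_CM; not a corollary; Q11.4-sentence-2 already refuted in dim ≥ 3. [cite: vanGeemen1994HodgeAV, (5.4.1)] -/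
theorem twelvefold_sqrtNeg3_dic13Jacobian_eq_split :
    (QuotientGroup.mk (Units.mk0 ((1 : ℚ) / 13 ^ 11) (by norm_num)) : weilNormResidueGroup 3) =
      splitDiscriminantClass 6 3 :=
  (twelvefold_dic13Jacobian_mk_C_eq_split_iff 3).2 SqrtNeg3.mem_13

/-- `J(C̃₁₂)` at `ℚ(√-23)` (`13 = (5/3)² + 23(2/3)²`): SPLIT, row `W12.23.1`. research route conditional on HC_CM; not a corollary; Q11.4-sentence-2 already refuted in dim ≥ 3. [cite: vanGeemen1994HodgeAV, (5.4.1)] -/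
theorem twelvefold_sqrtNeg23_dic13Jacobian_eq_split :
    (QuotientGroup.mk (Units.mk0 ((1 : ℚ) / 13 ^ 11) (by norm_num)) : weilNormResidueGroup 23) =
      splitDiscriminantClass 6 23 :=
  (twelvefold_dic13Jacobian_mk_C_eq_split_iff 23).2 SqrtNeg23.mem_13

end Dic13Jacobian

/-! ### §3 The binary octahedral CM fourfolds `(0; 3, 4, 8)`, `C = 1/1152` -/

section Octahedral

/-- **The frame-free class of the `2O` fourfold `(0;3,4,8)` is `[2]`**: `C = 1/1152 = 2 · (1/48)²`, `D_{2O} = ℍ_ℚ ⊗ ℚ(√2)`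
unramified at every finite place, `e = 2`: the component of `(P, K, Θ)` is the split one iff `2 ∈ Nm(ℚ(√-d)ˣ)`.
research route conditional on HC_CM; not a corollary; Q11.4-sentence-2 already refuted in dim ≥ 3. [cite: vanGeemen1994HodgeAV, (5.4.1)] -/
theorem fourfold_octahedral_mk_C_eq_split_iff (d : ℕ) :
    (QuotientGroup.mk (Units.mk0 ((1 : ℚ) / 1152) (by norm_num)) : weilNormResidueGroup d) =
      splitDiscriminantClass 2 d ↔ Units.mk0 (2 : ℚ) (by norm_num) ∈ normUnitsSubgroup ℚ (weilField d) :=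
  mk_eq_split_iff_of_eq_mul_norm_mul_sq (n := 2) (by decide) (a := (1 : ℚ) / 1152) (C := 2) (ν := 1)
    (s := (1 : ℚ) / 48) (by norm_num) (by norm_num) one_ne_zero (by norm_num) (by norm_num)
    (one_mem_normUnitsSubgroup d)

/-- `2O (0;3,4,8)` at `ℚ(√-3)`: NON-split, row `W4.3.2 = (2, ℚ(√-3), 2)` (the fourfold shadow of R1). research route conditional on HC_CM; not a corollary; Q11.4-sentence-2 already refuted in dim ≥ 3. [cite: vanGeemen1994HodgeAV, (5.4.1)] -/
theorem fourfold_sqrtNeg3_octahedral_ne_split :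
    (QuotientGroup.mk (Units.mk0 ((1 : ℚ) / 1152) (by norm_num)) : weilNormResidueGroup 3) ≠
      splitDiscriminantClass 2 3 := fun h =>
  Summit.HodgeConjecture.Ring2WeilNormDescent.two_not_mem_norm_three ((fourfold_octahedral_mk_C_eq_split_iff 3).1 h)

/-- `2O (0;3,4,8)` at `ℚ(√-11)`: NON-split, row `W4.11.2`. research route conditional on HC_CM; not a corollary; Q11.4-sentence-2 already refuted in dim ≥ 3. [cite: vanGeemen1994HodgeAV, (5.4.1)] -/
theorem fourfold_sqrtNeg11_octahedral_ne_split :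
    (QuotientGroup.mk (Units.mk0 ((1 : ℚ) / 1152) (by norm_num)) : weilNormResidueGroup 11) ≠
      splitDiscriminantClass 2 11 := fun h =>
  Summit.HodgeConjecture.Ring2WeilNormDescent.two_not_mem_norm_eleven ((fourfold_octahedral_mk_C_eq_split_iff 11).1 h)

/-- `2O (0;3,4,8)` at `ℚ(√-19)`: NON-split, row `W4.19.2`. research route conditional on HC_CM; not a corollary; Q11.4-sentence-2 already refuted in dim ≥ 3. [cite: vanGeemen1994HodgeAV, (5.4.1)] -/
theorem fourfold_sqrtNeg19_octahedral_ne_split :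
    (QuotientGroup.mk (Units.mk0 ((1 : ℚ) / 1152) (by norm_num)) : weilNormResidueGroup 19) ≠
      splitDiscriminantClass 2 19 := fun h =>
  SqrtNeg19.not_mem_2 ((fourfold_octahedral_mk_C_eq_split_iff 19).1 h)

/-- `2O (0;3,4,8)` at `ℚ(√-43)`: NON-split, row `W4.43.2`. research route conditional on HC_CM; not a corollary; Q11.4-sentence-2 already refuted in dim ≥ 3. [cite: vanGeemen1994HodgeAV, (5.4.1)] -/
theorem fourfold_sqrtNeg43_octahedral_ne_split :
    (QuotientGroup.mk (Units.mk0 ((1 : ℚ) / 1152) (by norm_num)) : weilNormResidueGroup 43) ≠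
      splitDiscriminantClass 2 43 := fun h =>
  SqrtNeg43.not_mem_2 ((fourfold_octahedral_mk_C_eq_split_iff 43).1 h)

/-- `2O (0;3,4,8)` at `ℚ(√-67)`: NON-split, row `W4.67.2`. research route conditional on HC_CM; not a corollary; Q11.4-sentence-2 already refuted in dim ≥ 3. [cite: vanGeemen1994HodgeAV, (5.4.1)] -/
theorem fourfold_sqrtNeg67_octahedral_ne_split :
    (QuotientGroup.mk (Units.mk0 ((1 : ℚ) / 1152) (by norm_num)) : weilNormResidueGroup 67) ≠
      splitDiscriminantClass 2 67 := fun h =>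
  SqrtNeg67.not_mem_2 ((fourfold_octahedral_mk_C_eq_split_iff 67).1 h)

/-- `2O (0;3,4,8)` at `ℚ(√-163)`: NON-split, row `W4.163.2`. research route conditional on HC_CM; not a corollary; Q11.4-sentence-2 already refuted in dim ≥ 3. [cite: vanGeemen1994HodgeAV, (5.4.1)] -/
theorem fourfold_sqrtNeg163_octahedral_ne_split :
    (QuotientGroup.mk (Units.mk0 ((1 : ℚ) / 1152) (by norm_num)) : weilNormResidueGroup 163) ≠
      splitDiscriminantClass 2 163 := fun h =>
  SqrtNeg163.not_mem_2 ((fourfold_octahedral_mk_C_eq_split_iff 163).1 h)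

/-- `2O (0;3,4,8)` at `ℚ(√-5)`: NON-split, row `W4.5.2` (ramified descent, ring2-b02's `SqrtNeg5.not_mem_2`). research route conditional on HC_CM; not a corollary; Q11.4-sentence-2 already refuted in dim ≥ 3. [cite: vanGeemen1994HodgeAV, (5.4.1)] -/
theorem fourfold_sqrtNeg5_octahedral_ne_split :
    (QuotientGroup.mk (Units.mk0 ((1 : ℚ) / 1152) (by norm_num)) : weilNormResidueGroup 5) ≠
      splitDiscriminantClass 2 5 := fun h =>
  Summit.HodgeConjecture.Ring2WeilNormDescent.SqrtNeg5.not_mem_2 ((fourfold_octahedral_mk_C_eq_split_iff 5).1 h)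

/-- `2O (0;3,4,8)` at `ℚ(√-6)`: NON-split, row `W4.6.2`. research route conditional on HC_CM; not a corollary; Q11.4-sentence-2 already refuted in dim ≥ 3. [cite: vanGeemen1994HodgeAV, (5.4.1)] -/
theorem fourfold_sqrtNeg6_octahedral_ne_split :
    (QuotientGroup.mk (Units.mk0 ((1 : ℚ) / 1152) (by norm_num)) : weilNormResidueGroup 6) ≠
      splitDiscriminantClass 2 6 := fun h =>
  Summit.HodgeConjecture.Ring2WeilNormDescent.SqrtNeg6.not_mem_2 ((fourfold_octahedral_mk_C_eq_split_iff 6).1 h)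

/-- `2O (0;3,4,8)` at `ℚ(√-10)`: NON-split, row `W4.10.2`. research route conditional on HC_CM; not a corollary; Q11.4-sentence-2 already refuted in dim ≥ 3. [cite: vanGeemen1994HodgeAV, (5.4.1)] -/
theorem fourfold_sqrtNeg10_octahedral_ne_split :
    (QuotientGroup.mk (Units.mk0 ((1 : ℚ) / 1152) (by norm_num)) : weilNormResidueGroup 10) ≠
      splitDiscriminantClass 2 10 := fun h =>
  Summit.HodgeConjecture.Ring2WeilNormDescent.SqrtNeg10.not_mem_2 ((fourfold_octahedral_mk_C_eq_split_iff 10).1 h)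

/-- `2O (0;3,4,8)` at `ℚ(√-13)`: NON-split, row `W4.13.2`. research route conditional on HC_CM; not a corollary; Q11.4-sentence-2 already refuted in dim ≥ 3. [cite: vanGeemen1994HodgeAV, (5.4.1)] -/
theorem fourfold_sqrtNeg13_octahedral_ne_split :
    (QuotientGroup.mk (Units.mk0 ((1 : ℚ) / 1152) (by norm_num)) : weilNormResidueGroup 13) ≠
      splitDiscriminantClass 2 13 := fun h =>
  Summit.HodgeConjecture.Ring2WeilNormDescent.SqrtNeg13.not_mem_2 ((fourfold_octahedral_mk_C_eq_split_iff 13).1 h)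

/-- `2O (0;3,4,8)` at `ℚ(√-15)`: NON-split, row `W4.15.2`. research route conditional on HC_CM; not a corollary; Q11.4-sentence-2 already refuted in dim ≥ 3. [cite: vanGeemen1994HodgeAV, (5.4.1)] -/
theorem fourfold_sqrtNeg15_octahedral_ne_split :
    (QuotientGroup.mk (Units.mk0 ((1 : ℚ) / 1152) (by norm_num)) : weilNormResidueGroup 15) ≠
      splitDiscriminantClass 2 15 := fun h =>
  Summit.HodgeConjecture.Ring2WeilNormDescent.SqrtNeg15.not_mem_2 ((fourfold_octahedral_mk_C_eq_split_iff 15).1 h)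

/-- `2O (0;3,4,8)` at `ℚ(i)`: SPLIT (`2 = 1² + 1²`), row `W4.1.1`. research route conditional on HC_CM; not a corollary; Q11.4-sentence-2 already refuted in dim ≥ 3. [cite: vanGeemen1994HodgeAV, (5.4.1)] -/
theorem fourfold_sqrtNeg1_octahedral_eq_split :
    (QuotientGroup.mk (Units.mk0 ((1 : ℚ) / 1152) (by norm_num)) : weilNormResidueGroup 1) =
      splitDiscriminantClass 2 1 :=
  (fourfold_octahedral_mk_C_eq_split_iff 1).2 SqrtNeg1.mem_2

end Octahedral

end Summit.HodgeConjecture.HodgeConjecture.Ring2.WeilCoverage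

end
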